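import Mathlib
import Summits.NavierStokesRegularity.NavierStokesRegularity.Theorems.EulerZoomLiouvillePowerGaugeEulerLiouvilleHelicityTubeStarvation
import Summits.NavierStokesRegularity.NavierStokesRegularity.Theorems.EulerZoomLiouvillePowerGaugeEulerLiouvilleHelicityTubeTransport
import HarnessLib

/-!
# Crux `EulerZoomLiouville.PowerGaugeEulerLiouville` (stmt-NavierStokesRegularity-19832), line `helicity-tube`:
# THE ZERO-HELICITY LAW, UNCONDITIONAL (T1 ∘ T2), and the emptiness of the stratum `IsHelicalTubePast`

Route №10 `EulerZoomLiouville` (NavierStokesRegularity), crux E.  Line `helicity-tube` (ideator ns-idea-11 g4;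
`Cruxes/PowerGaugeEulerLiouville/Lines/helicity_tube.lean`).  Its two provable stubs are in the tree: T1
`HelicityTube.tubesPersist_of_driftingPastWith` (…HelicityTubeTransport, Moffatt's partial-helicity invariance) and T2
`HelicityTube.weightedHelicity_eq_zero_of_tubesPersist` (…HelicityTubeStarvation, the zero-helicity law GIVEN persistence).  This file
composes them into the two member-level statements the LEAD's skeleton consumes by one `exact`:

* `weightedHelicity_eq_zero` — **THE ZERO-HELICITY LAW**: for a member `(u,p,H,c)` of the power-gauged class (`0 < ρ ≤ 1/2`) with a
  drifting classical far past `(T₁, M, κ)` of exponent `κ > (1−3ρ)/(2−3ρ)`, EVERY coherent vortex-tube datum `(χ, R)` of every slice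
  `u(τ)`, `τ < T₁`, has zero weighted (Moffatt) helicity `∫ χ ⟪u(τ), curl u(τ)⟫ = 0` (no persistence hypothesis: T1 supplies it);
* `false_of_helicalTubePast` — hence the line's stratum `IsHelicalTubePast ρ u p` (`δ`-unfolded: such a past carrying, at some `τ < T₁`, a
  tube datum of NON-ZERO weighted helicity) is EMPTY for members, and `ae_eq_zero_of_gauge_of_helicalTubePast` is the corresponding (vacuous)
  member-level filler in the shape of the skeleton's strata (`InClass → IsHelicalTubePast ρ u p → u = 0` a.e.).

WHAT THIS IS NOT: not NS, not the crux — helpers `--supports` stmt-19832 (statements about a hypothetical Euler zoom-limit class: one named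
classical stratum is empty); the residue T3 `stub_helicityRest` (members outside the stratum) stays OPEN; 19832 is a crux CLASS on the model
lattice (E/NS strata); no summit statement is proved here and nothing here bears on NS regularity itself.  [folklore; cite:
MajdaBertozziCUP2002 §1.6 Props. 1.10–1.12; Moffatt 1969]
-/

noncomputable section

-- flat `Theorems/<Route><Decl>…` files of one crux share the namespace of the crux (tree convention)
set_option linter.dupNamespace false

open MeasureTheory Set Filter Topology Metric Function Real InnerProductSpace
open scoped NNReal ENNReal RealInnerProductSpace ContDiff

namespace Summit.NavierStokesRegularity.NavierStokesRegularity.Theorems.PowerGaugeEulerLiouville.HelicityTube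

open Literature.Analysis Literature.Analysis.FluidPDE

variable {u : ℝ → EuclideanSpace ℝ (Fin 3) → EuclideanSpace ℝ (Fin 3)} {p : ℝ → EuclideanSpace ℝ (Fin 3) → ℝ}
  {H : ℝ → EuclideanSpace ℝ (Fin 3) → EuclideanSpace ℝ (Fin 3) →L[ℝ] EuclideanSpace ℝ (Fin 3)} {c : ℝ≥0}

/-- **THE ZERO-HELICITY LAW of the line `helicity-tube` (T1 ∘ T2, unconditional).**  For a member of the power-gauged class (`0 < ρ ≤ 1/2`)
with a drifting classical far past `(T₁, M, κ)` (`‖u(r,·)‖_∞ ≤ M(−r)^{−κ}` for `r < T₁ ≤ 0`, `κ < 1`, gradient bounded on compact time sets)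
of exponent `κ > (1−3ρ)/(2−3ρ)`, every tube datum `(χ, R)` (`χ ∈ C^∞`, `|χ| ≤ 1`, `χ = 0` off `B(0,R)`, `Dχ[curl u(τ)] ≡ 0`) of every slice
`u(τ)`, `τ < T₁`, has `∫ χ ⟪u(τ), curl u(τ)⟫ = 0`. [cite: MajdaBertozziCUP2002, §1.6 Props. 1.10–1.12] -/
theorem weightedHelicity_eq_zero {ρ : ℝ} (hρ : 0 < ρ) (hρ2 : ρ ≤ 1 / 2)
    (hsw : IsSuitableWeakSolutionOn (slab (EuclideanSpace ℝ (Fin 3)) (Set.Iio 0) isOpen_Iio) 0 0 u p)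
    (hH : HasWeakSpatialGradientOn (slab (EuclideanSpace ℝ (Fin 3)) (Set.Iio 0) isOpen_Iio) u H)
    (hgauge : ∀ a : ℝ, 0 < a →
      ENNReal.ofReal (a ^ (2 * ρ)) * cknA a (0 : ℝ × EuclideanSpace ℝ (Fin 3)) u +
          ENNReal.ofReal (a ^ ρ) * cknE a (0 : ℝ × EuclideanSpace ℝ (Fin 3)) H +
        ENNReal.ofReal (a ^ (2 * ρ)) * cknD a (0 : ℝ × EuclideanSpace ℝ (Fin 3)) p ≤ (c : ℝ≥0∞))
    {T₁ M κ : ℝ} (hcl : IsClassicalEulerSolutionOn (Set.Iio 0) 0 u p) (hT₁ : T₁ ≤ 0) (hM : 0 ≤ M) (hκ : κ < 1)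
    (henv : ∀ τ : ℝ, τ < T₁ → ∀ x : EuclideanSpace ℝ (Fin 3), ‖u τ x‖ ≤ M * (-τ) ^ (-κ))
    (hgrad : ∀ t₁ t₂ : ℝ, t₁ < t₂ → t₂ < 0 →
      ∃ L : ℝ, ∀ τ ∈ Set.Icc t₁ t₂, ∀ x : EuclideanSpace ℝ (Fin 3), ‖fderiv ℝ (u τ) x‖ ≤ L)
    (hκρ : (1 - 3 * ρ) / (2 - 3 * ρ) < κ)
    {τ : ℝ} (hτ : τ < T₁) {χ : EuclideanSpace ℝ (Fin 3) → ℝ} {R : ℝ} (hR : 0 < R)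
    (hχ : ContDiff ℝ ∞ χ ∧ (∀ x : EuclideanSpace ℝ (Fin 3), |χ x| ≤ 1) ∧
      (∀ x : EuclideanSpace ℝ (Fin 3), R ≤ ‖x‖ → χ x = 0) ∧
      ∀ x : EuclideanSpace ℝ (Fin 3), fderiv ℝ χ x (curl (u τ) x) = 0) :
    ∫ x, χ x * ⟪u τ x, curl (u τ) x⟫ = 0 :=
  weightedHelicity_eq_zero_of_tubesPersist ρ hρ hρ2 u p H c ⟨hsw, hH, hgauge⟩ T₁ M κ
    ⟨hcl, hT₁, hM, hκ, henv, hgrad⟩ hκρ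
    (tubesPersist_of_driftingPastWith u p T₁ M κ ⟨hcl, hT₁, hM, hκ, henv, hgrad⟩) τ hτ χ R hR hχ

/-- **The stratum `IsHelicalTubePast` is EMPTY for members** (`δ`-unfolded): a member of the power-gauged class (`0 < ρ ≤ 1/2`) admits no
drifting classical far past of exponent `κ > (1−3ρ)/(2−3ρ)` carrying, at some time `τ < T₁`, a coherent vortex-tube datum of NON-ZERO
weighted helicity. [folklore] -/
theorem false_of_helicalTubePast {ρ : ℝ} (hρ : 0 < ρ) (hρ2 : ρ ≤ 1 / 2)
    (hsw : IsSuitableWeakSolutionOn (slab (EuclideanSpace ℝ (Fin 3)) (Set.Iio 0) isOpen_Iio) 0 0 u p)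
    (hH : HasWeakSpatialGradientOn (slab (EuclideanSpace ℝ (Fin 3)) (Set.Iio 0) isOpen_Iio) u H)
    (hgauge : ∀ a : ℝ, 0 < a →
      ENNReal.ofReal (a ^ (2 * ρ)) * cknA a (0 : ℝ × EuclideanSpace ℝ (Fin 3)) u +
          ENNReal.ofReal (a ^ ρ) * cknE a (0 : ℝ × EuclideanSpace ℝ (Fin 3)) H +
        ENNReal.ofReal (a ^ (2 * ρ)) * cknD a (0 : ℝ × EuclideanSpace ℝ (Fin 3)) p ≤ (c : ℝ≥0∞))
    (hS : ∃ T₁ M κ : ℝ,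
      (IsClassicalEulerSolutionOn (Set.Iio 0) 0 u p ∧ T₁ ≤ 0 ∧ 0 ≤ M ∧ κ < 1 ∧
          (∀ τ : ℝ, τ < T₁ → ∀ x : EuclideanSpace ℝ (Fin 3), ‖u τ x‖ ≤ M * (-τ) ^ (-κ)) ∧
          (∀ t₁ t₂ : ℝ, t₁ < t₂ → t₂ < 0 →
            ∃ L : ℝ, ∀ τ ∈ Set.Icc t₁ t₂, ∀ x : EuclideanSpace ℝ (Fin 3), ‖fderiv ℝ (u τ) x‖ ≤ L)) ∧
        (1 - 3 * ρ) / (2 - 3 * ρ) < κ ∧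
        ∃ τ : ℝ, τ < T₁ ∧ ∃ (χ : EuclideanSpace ℝ (Fin 3) → ℝ) (R : ℝ), 0 < R ∧
          (ContDiff ℝ ∞ χ ∧ (∀ x : EuclideanSpace ℝ (Fin 3), |χ x| ≤ 1) ∧
              (∀ x : EuclideanSpace ℝ (Fin 3), R ≤ ‖x‖ → χ x = 0) ∧
              ∀ x : EuclideanSpace ℝ (Fin 3), fderiv ℝ χ x (curl (u τ) x) = 0) ∧
            (∫ x, χ x * ⟪u τ x, curl (u τ) x⟫) ≠ 0) :
    False := by
  obtain ⟨T₁, M, κ, ⟨hcl, hT₁, hM, hκ, henv, hgrad⟩, hκρ, τ, hτ, χ, R, hR, hχ, hne⟩ := hS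
  exact hne (weightedHelicity_eq_zero hρ hρ2 hsw hH hgauge hcl hT₁ hM hκ henv hgrad hκρ hτ hR hχ)

/-- **Member-level filler in the shape of the skeleton's strata**: a member of the power-gauged class (`0 < ρ ≤ 1/2`) lying in the stratum
`IsHelicalTubePast ρ u p` (`δ`-unfolded) vanishes a.e. on the past slab — vacuously, the stratum being empty (`false_of_helicalTubePast`).
[folklore] -/
theorem ae_eq_zero_of_gauge_of_helicalTubePast {ρ : ℝ} (hρ : 0 < ρ) (hρ2 : ρ ≤ 1 / 2)
    (hsw : IsSuitableWeakSolutionOn (slab (EuclideanSpace ℝ (Fin 3)) (Set.Iio 0) isOpen_Iio) 0 0 u p)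
    (hH : HasWeakSpatialGradientOn (slab (EuclideanSpace ℝ (Fin 3)) (Set.Iio 0) isOpen_Iio) u H)
    (hgauge : ∀ a : ℝ, 0 < a →
      ENNReal.ofReal (a ^ (2 * ρ)) * cknA a (0 : ℝ × EuclideanSpace ℝ (Fin 3)) u +
          ENNReal.ofReal (a ^ ρ) * cknE a (0 : ℝ × EuclideanSpace ℝ (Fin 3)) H +
        ENNReal.ofReal (a ^ (2 * ρ)) * cknD a (0 : ℝ × EuclideanSpace ℝ (Fin 3)) p ≤ (c : ℝ≥0∞))
    (hS : ∃ T₁ M κ : ℝ,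
      (IsClassicalEulerSolutionOn (Set.Iio 0) 0 u p ∧ T₁ ≤ 0 ∧ 0 ≤ M ∧ κ < 1 ∧
          (∀ τ : ℝ, τ < T₁ → ∀ x : EuclideanSpace ℝ (Fin 3), ‖u τ x‖ ≤ M * (-τ) ^ (-κ)) ∧
          (∀ t₁ t₂ : ℝ, t₁ < t₂ → t₂ < 0 →
            ∃ L : ℝ, ∀ τ ∈ Set.Icc t₁ t₂, ∀ x : EuclideanSpace ℝ (Fin 3), ‖fderiv ℝ (u τ) x‖ ≤ L)) ∧
        (1 - 3 * ρ) / (2 - 3 * ρ) < κ ∧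
        ∃ τ : ℝ, τ < T₁ ∧ ∃ (χ : EuclideanSpace ℝ (Fin 3) → ℝ) (R : ℝ), 0 < R ∧
          (ContDiff ℝ ∞ χ ∧ (∀ x : EuclideanSpace ℝ (Fin 3), |χ x| ≤ 1) ∧
              (∀ x : EuclideanSpace ℝ (Fin 3), R ≤ ‖x‖ → χ x = 0) ∧
              ∀ x : EuclideanSpace ℝ (Fin 3), fderiv ℝ χ x (curl (u τ) x) = 0) ∧
            (∫ x, χ x * ⟪u τ x, curl (u τ) x⟫) ≠ 0) :
    uncurry u =ᵐ[volume.restrict (Set.Iio (0 : ℝ) ×ˢ (Set.univ : Set (EuclideanSpace ℝ (Fin 3))))] 0 :=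
  (false_of_helicalTubePast hρ hρ2 hsw hH hgauge hS).elim

end Summit.NavierStokesRegularity.NavierStokesRegularity.Theorems.PowerGaugeEulerLiouville.HelicityTube

end
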